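import Summits.AtomisticToContinuum.Crystallization.Theorems.OverbindingBudgetGrossMargin

/-!
# OverbindingBudget — «MisfitCensus»: the gross Liouville law is a misfit census (decomp-a2c lens-4, generation 37)

THIS FILE (statements + seams): the census predicates, the statements MEG / SEG / GEG / `GapFreeShells` / MER, the partition `bad_cases` and the
seams, the locality of `RT`, a packing bound and the arithmetic of the glue.  COMPANION `…OverbindingBudgetMisfitCensus` (imports this file): the
glue `misfitRelax_of_misfitEnergyGap` (PROVED) and cone XLI `rdef_of_ceg_meg`.

Helper file (`--supports stmt-AtomisticToContinuum-31280`).  Target: the residual of the cut of record (cone XL, slot `hPG`),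
`GrossLiouvilleLaw (1/250) 10` («PGL»: a uniformly recurrent, `9/10`-covering, thin-cored texture with NO globally clean admissible scale,
SPARSE `(1/100)`-charge, LOCALLY OPTIMAL and VIRIAL-BALANCED, that carries robust gapped-twelve violators `L`-densely at every admissible scale,
has strained cubes).  Lens: minimal counterexample / extremal reduction — strip the counterexample of every hypothesis the contradiction does
not use, and read off the currency in which the contradiction is an inequality.

## §1 Finding: PGL is an ENERGY CENSUS; its four equilibrium hypotheses are not load-bearing

A robust violator `y` of `Y` (`¬ RT a s Y y` for all `s ∈ (0,t)`) is a margin-`0` violator (`rt_mono`), and the relaxed gapped-twelve test is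
LOCAL (`rt_of_local`: it reads only `Y ∩ B(y, 63a/50)`), so a violator two units inside a cube chunk `F = Y ∩ Q_ℓ` is a violator OF THE CHUNK,
i.e. in the finite configuration enumerating `F` it is either `(1/100)`-CHARGED or BAD := charge-free but failing `RT a 0`.  By the landed grid
lemma (`grid_lower_bound`) the violators have cube density `≥ (8s³)⁻¹`, `s = 2 max(L,0) + 2`; by sparse charge the charged ones have density
`< ρ` for every `ρ > 0` eventually; so BAD sites have positive density in every large chunk, and «strained cubes» follows from ONE inequality on
finite configurations — the **misfit energy gap**

    MEG(a, s):  ∃ c > 0, C,  ∀ N, ∀ injective y : Fin N → ℝ³,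
                N·e⋆ + c·#{i : (1/100)-charge-free, ¬ RT a s (range y) (y i)} − C·#{i : charged} − C·N^{2/3} ≤ E_LJ(y),

`e⋆ = ⨅ periodic energy per particle` — the EXACT SIBLING of the shared crux `ChargedEnergyGap` (stmt-14231: `N e⋆ + κ #charged − C N^{2/3} ≤
E_LJ(y)`), in the same currency with the same slack, pricing ELASTIC MISFIT instead of topological charge (`misfitRelax_of_misfitEnergyGap`,
PROVED, template `…ElasticSplitPricing.chargeDensityRelax_of_chargedEnergyGap`).  Uniform recurrence, thin cores, the absence of a clean scale,
local optimality and virial balance are NOT used: `MisfitRelax a` (uniformly discrete + `9/10`-covering + sparse charge + `ViolatorsL a t L` ⇒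
strained cubes) implies `ElasticLiouvilleLaw T₀ D` and `GrossLiouvilleLaw T₀ D` at EVERY margin (`elasticLiouvilleLaw_of_misfitRelax`,
`grossLiouvilleLaw_of_misfitRelax`).

The scale.  `a = 122/125 = 0.976` centres the window of `RT a 0`: SHORT = own nearest-neighbour distance `< 49a/50 = 0.95648`, LONG = a bond
`> 51a/50 = 0.99552`, GAP = a non-bonded site closer than `63a/50 = 1.22976`.  The certified Barlow shell `[d⋆, 1.01 d⋆] = [0.9712, 0.9810]`
(`d⋆⁶ = L₁₂/L₆`, `Literature…HcpFccLatticeSumsCertificate`: `L₆ʰ ∈ [14.4542, 14.4593]`, `L₁₂ʰ ∈ [12.13229, 12.13230]`) sits `0.0147` inside both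
edges, so near-optimal Barlow matter (all polytypes, letter-dependent relaxations `≈ 10⁻³` included) is NOT bad, and MEG is TRUE-type for the
same reason CEG is: energy density `e⋆` is attained only window-clean (periodic Barlow stackings are among the `Q`, aperiodic ones are limits
of periodic ones, so `e_B ≥ e⋆` for every stacking `B`) and
leaving the window by `1.47 %` in scale costs Cauchy–Born energy `½·K·(0.0147)² > 0` per site in aggregate.

## §2 The node (seams PROVED: `bad_cases`, `misfitEnergyGap_of_scale_gap`, `misfitEnergyGap_zero_of_scale_gapFree`)

    PGL = GrossLiouvilleLaw (1/250) 10  ⟸  MisfitRelax (122/125)  ⟸  MisfitEnergyGap (122/125) 0  ⟸  ScaleEnergyGap ∧ GapEnergyGap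
                                                                                                  ⟸  ScaleEnergyGap (122/125) 0 ∧ GapFreeShells

* `ScaleEnergyGap a s` [«SEG» · KERNEL-WEAKER than MEG (prices only the bad sites of SHORT/LONG type) · ENERGY · the Cauchy–Born coercivity of
  `≤ 1 %`-charged matter proper · UNDECIDED · INSTRUMENTABLE: census TAG 185 «I-ELAS2» (certified LJ elastic moduli / Born margins at d⋆) is its
  linearisation; decidable rung = the 1-D certified inequality `e_fcc(σ), e_hcp(σ) ≥ e_hcp(d⋆) + c` for `σ ∉ [49a/50, 51a/50·(1/1.01)]`].
* `GapEnergyGap a s` [«GEG» · KERNEL-WEAKER than MEG (prices only the bad sites of GAP type: a non-bonded site inside `63a/50 − s`)].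
* `GapFreeShells` [ALTERNATIVE second piece · potential-free GEOMETRY · scale-free: a `(1/100)`-charge-free site has no NON-BONDED site within
  `9/7` of its own nearest-neighbour distance; `63/50 · 7/9 = 49/50`, so at margin `0` GAP ⊆ SHORT · TRUE iff every `1 %`-charge-free twelve-shell
  has covering radius `< 49.3°` (cuboctahedron / anticuboctahedron: `45.0°`) · UNDECIDED · INSTRUMENTABLE (kill-test: a 4-regular `1 %`-shell with
  a pentagonal hole, face types `(t,q,p) ∈ {(9,4,1),(10,2,2),(11,0,3)}`) · strictly weaker than slot `TwoShellShape`].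
The partition `Bad ⊆ Short ∪ Long ∪ Gap` (`bad_cases`) is the three clauses of `RT` read against the twelve bonds of a charge-free site.

## §3 Cone XLI — FOUR slots (`rdef_of_ceg_meg`; split forms `rdef_of_ceg_scale_gap`, `rdef_of_ceg_scale_gapFree`)

    RobustDefectLimitWindows  ⟸  ChargedEnergyGap ∧ MisfitEnergyGap (122/125) 0 ∧ CleanlessExcessT ∧ CoherentResidual 10

via `MisfitRelax ⇒ ElasticLiouvilleLaw 2 10` and generation 36's `rdef_of_ceg_liouville_two`.  Slots 3–7d of cone XL (two-shell shape, Barlow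
gluing, periodic door, stacked reduction, registry, affine tables, pinning, force certificates) are BYPASSED, not contradicted: they remain the
geometric discharge of the CLEAN sub-case.  Nothing here is stated at margin `2` (standing guard of row 528/544: `BalancedLiouvilleLaw` vacuous,
`CompressedVirialLaw` false-type there); every statement is reference-free.
-/

namespace Summit.AtomisticToContinuum.Crystallization.Theorems.OverbindingBudgetMisfitCensusStatements

open Filter Metric Set Topology
open scoped BigOperators
open Literature.MathematicalPhysics.StatisticalMechanics
open Literature.Geometry.DiscreteGeometry (IsChargeFree bondGraph nearestDist nearestDist_le_dist bondGraph_adj)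
open Summit.AtomisticToContinuum.Crystallization.Theses.OverbindingBudget (RobustDefectLimitWindows)
open Summit.AtomisticToContinuum.Crystallization.Theses.PricedLinkCensus (ChargedEnergyGap)
open Summit.AtomisticToContinuum.Crystallization.Theorems.OverbindingBudgetCubeTails (card_le_of_separated_of_box)
open Summit.AtomisticToContinuum.Crystallization.Theorems.OverbindingBudgetGradedBareness (CleanlessExcessT)
open Summit.AtomisticToContinuum.Crystallization.Theorems.OverbindingBudgetCoherentCut (CoherentResidual)
open Summit.AtomisticToContinuum.Crystallization.Theorems.OverbindingBudgetViolatorDensityFloor (RT)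
open Summit.AtomisticToContinuum.Crystallization.Theorems.OverbindingBudgetRecurrentDustStatements (ViolatorsL rt_mono window_finite
  window_finite_lt)
open Summit.AtomisticToContinuum.Crystallization.Theorems.OverbindingBudgetBindingSignLaw (grid_lower_bound)
open Summit.AtomisticToContinuum.Crystallization.Theorems.OverbindingBudgetExcessInstability (finite_inter_cube)
open Summit.AtomisticToContinuum.Crystallization.Theorems.OverbindingBudgetEdgeRelaxationStatements (CleanClass StrainedCubes)
open Summit.AtomisticToContinuum.Crystallization.Theorems.OverbindingBudgetElasticSplitStatements (chargedCount DenseCharge SparseCharge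
  LocallyOptimal VirialBalanced ElasticLiouvilleLaw SparseChargeRelax)
open Summit.AtomisticToContinuum.Crystallization.Theorems.OverbindingBudgetElasticSplitPricing (rpow_two_thirds_le
  two_mul_interactionEnergy_eq_sum_sum_image groundStateEnergy_le_eventually)
open Summit.AtomisticToContinuum.Crystallization.Theorems.OverbindingBudgetGrossMargin (GrossClass GrossLiouvilleLaw rdef_of_ceg_liouville_two)

/-! ## §A  The census predicates of a finite configuration -/

variable {N : ℕ}

/-- The site `i` of the finite configuration `y` is **bad** at spacing `a`, margin `s`: it is `(1/100)`-charge-free but FAILS the `s`-relaxed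
gapped-twelve test `RT a s`, computed inside the configuration (`Set.range y`). -/
def Bad (a s : ℝ) (y : Fin N → EuclideanSpace ℝ (Fin 3)) (i : Fin N) : Prop :=
  IsChargeFree (1 / 100 : ℝ) y i ∧ ¬ RT a s (Set.range y) (y i)

/-- SHORT type: the own nearest-neighbour distance of `i` is below the window, `nn_i < 49a/50 − s`. -/
def Short (a s : ℝ) (y : Fin N → EuclideanSpace ℝ (Fin 3)) (i : Fin N) : Prop :=
  nearestDist y i < a * (1 - 1 / 50) - s

/-- LONG type: some bond of `i` (scale-free bond graph at tolerance `1/100`) is longer than the window, `> 51a/50 + s`. -/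
def Long (a s : ℝ) (y : Fin N → EuclideanSpace ℝ (Fin 3)) (i : Fin N) : Prop :=
  ∃ j : Fin N, (bondGraph (1 / 100 : ℝ) y).Adj i j ∧ a * (1 + 1 / 50) + s < dist (y i) (y j)

/-- GAP type: some other site NOT bonded to `i` lies inside the gap radius, `< 63a/50 − s`. -/
def Gap (a s : ℝ) (y : Fin N → EuclideanSpace ℝ (Fin 3)) (i : Fin N) : Prop :=
  ∃ j : Fin N, j ≠ i ∧ ¬ (bondGraph (1 / 100 : ℝ) y).Adj i j ∧ dist (y i) (y j) < a * (63 / 50) - s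

/-- The number of bad sites. -/
noncomputable def badCount (a s : ℝ) (y : Fin N → EuclideanSpace ℝ (Fin 3)) : ℕ :=
  Nat.card {i : Fin N // Bad a s y i}

/-- The number of bad sites of SHORT or LONG type (the elastic-misfit sites). -/
noncomputable def scaleCount (a s : ℝ) (y : Fin N → EuclideanSpace ℝ (Fin 3)) : ℕ :=
  Nat.card {i : Fin N // Bad a s y i ∧ (Short a s y i ∨ Long a s y i)}

/-- The number of bad sites of GAP type. -/
noncomputable def gapCount (a s : ℝ) (y : Fin N → EuclideanSpace ℝ (Fin 3)) : ℕ :=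
  Nat.card {i : Fin N // Bad a s y i ∧ Gap a s y i}

/-! ## §B  The census statements -/

/-- **`MisfitEnergyGap a s` («MEG»)** — the misfit sibling of `ChargedEnergyGap`: uniformly in `N`, the Lennard-Jones energy of an injective
`N`-configuration exceeds `N e⋆` by `c > 0` per BAD site (charge-free at `1/100` but failing `RT a s` inside the configuration), up to `C` per
charged site and a surface term `C N^{2/3}`. -/
def MisfitEnergyGap (a s : ℝ) : Prop :=
  ∃ c C : ℝ, 0 < c ∧ ∀ (N : ℕ) (y : Fin N → EuclideanSpace ℝ (Fin 3)), Function.Injective y →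
    (N : ℝ) * (⨅ Q : PeriodicConfiguration 3, Q.energyPerParticle lennardJones) + c * (badCount a s y : ℝ)
      - C * (chargedCount y : ℝ) - C * (N : ℝ) ^ (2 / 3 : ℝ) ≤ interactionEnergy lennardJones y

/-- **`ScaleEnergyGap a s` («SEG»)** — MEG for the bad sites of SHORT/LONG type only: the aggregate Cauchy–Born coercivity of `≤ 1 %`-charged
matter about the window `[49a/50 − s, 51a/50 + s]`.  KERNEL-WEAKER than MEG. -/
def ScaleEnergyGap (a s : ℝ) : Prop :=
  ∃ c C : ℝ, 0 < c ∧ ∀ (N : ℕ) (y : Fin N → EuclideanSpace ℝ (Fin 3)), Function.Injective y →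
    (N : ℝ) * (⨅ Q : PeriodicConfiguration 3, Q.energyPerParticle lennardJones) + c * (scaleCount a s y : ℝ)
      - C * (chargedCount y : ℝ) - C * (N : ℝ) ^ (2 / 3 : ℝ) ≤ interactionEnergy lennardJones y

/-- **`GapEnergyGap a s` («GEG»)** — MEG for the bad sites of GAP type only.  KERNEL-WEAKER than MEG. -/
def GapEnergyGap (a s : ℝ) : Prop :=
  ∃ c C : ℝ, 0 < c ∧ ∀ (N : ℕ) (y : Fin N → EuclideanSpace ℝ (Fin 3)), Function.Injective y →
    (N : ℝ) * (⨅ Q : PeriodicConfiguration 3, Q.energyPerParticle lennardJones) + c * (gapCount a s y : ℝ)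
      - C * (chargedCount y : ℝ) - C * (N : ℝ) ^ (2 / 3 : ℝ) ≤ interactionEnergy lennardJones y

/-- **`GapFreeShells`** (potential-free, scale-free): at a `(1/100)`-charge-free site of any finite configuration, every OTHER site that is not
bonded to it lies at distance `≥ 9/7` of its own nearest-neighbour distance.  (TRUE iff the twelve bond directions of every `1 %`-charge-free
shell cover the sphere with covering radius `< 49.3°`; the cuboctahedral and anticuboctahedral shells have `45.0°`.) -/
def GapFreeShells : Prop :=
  ∀ (N : ℕ) (y : Fin N → EuclideanSpace ℝ (Fin 3)), Function.Injective y → ∀ i : Fin N, IsChargeFree (1 / 100 : ℝ) y i →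
    ∀ j : Fin N, j ≠ i → ¬ (bondGraph (1 / 100 : ℝ) y).Adj i j → 9 / 7 * nearestDist y i ≤ dist (y i) (y j)

/-! ## §C  The partition of the bad sites (PROVED) -/

/-- **A bad site is SHORT, LONG or GAP.**  The three clauses of `RT a s` read against the twelve bonds of a charge-free site: a site closer
than `49a/50 − s` forces SHORT (`nn_i ≤` every distance); a site strictly between `51a/50 + s` and `63a/50 − s` is a LONG bond or a GAP intruder;
fewer than twelve sites within `51a/50 + s` forces a LONG bond (the twelve bonded sites are distinct points); more than twelve sites inside
`63a/50 − s` forces a GAP intruder (only twelve are bonded). [this file] -/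
theorem bad_cases {a s : ℝ} {y : Fin N → EuclideanSpace ℝ (Fin 3)} (hy : Function.Injective y) {i : Fin N} (h : Bad a s y i) :
    Short a s y i ∨ Long a s y i ∨ Gap a s y i := by
  classical
  obtain ⟨hcf, hrt⟩ := h
  by_contra hcon
  simp only [not_or] at hcon
  obtain ⟨hS, hL, hG⟩ := hcon
  simp only [Short, not_lt] at hS
  simp only [Long, not_exists, not_and, not_lt] at hL
  simp only [Gap, not_exists, not_and, not_lt] at hG
  apply hrt
  set nbr : Set (Fin N) := (bondGraph (1 / 100 : ℝ) y).neighborSet i with hnbr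
  have hfin : nbr.Finite := hcf.finite_neighborSet
  have hcard : nbr.ncard = 12 := hcf.1
  refine ⟨?_, ?_, ?_⟩
  · -- clause 1: at most twelve sites inside the gap radius — they are all bonded
    have hsub : {w ∈ Set.range y | w ≠ y i ∧ dist (y i) w < a * (63 / 50) - s} ⊆ y '' nbr := by
      rintro w ⟨⟨j, rfl⟩, hne, hd⟩
      have hji : j ≠ i := fun h => hne (by rw [h])
      have hadj : (bondGraph (1 / 100 : ℝ) y).Adj i j := by
        by_contra hna
        exact absurd (hG j hji hna) (not_le.2 hd)
      exact ⟨j, (SimpleGraph.mem_neighborSet _ _ _).2 hadj, rfl⟩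
    calc {w ∈ Set.range y | w ≠ y i ∧ dist (y i) w < a * (63 / 50) - s}.ncard ≤ (y '' nbr).ncard :=
          Set.ncard_le_ncard hsub (hfin.image y)
      _ ≤ nbr.ncard := Set.ncard_image_le hfin
      _ = 12 := hcard
  · -- clause 2: the twelve bonded sites are distinct points within `51a/50 + s`
    have hsub : y '' nbr ⊆ {w ∈ Set.range y | w ≠ y i ∧ dist (y i) w ≤ a * (1 + 1 / 50) + s} := by
      rintro w ⟨j, hj, rfl⟩
      have hadj : (bondGraph (1 / 100 : ℝ) y).Adj i j := (SimpleGraph.mem_neighborSet _ _ _).1 hj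
      have hij : i ≠ j := (bondGraph_adj.1 hadj).1
      exact ⟨⟨j, rfl⟩, fun h => hij (hy h).symm, hL j hadj⟩
    have hfin2 : {w ∈ Set.range y | w ≠ y i ∧ dist (y i) w ≤ a * (1 + 1 / 50) + s}.Finite :=
      (Set.finite_range y).subset fun w hw => hw.1
    calc 12 = nbr.ncard := hcard.symm
      _ = (y '' nbr).ncard := (Set.ncard_image_of_injective nbr hy).symm
      _ ≤ _ := Set.ncard_le_ncard hsub hfin2
  · -- clause 3: the window dichotomy
    rintro w ⟨j, rfl⟩ hne
    have hji : j ≠ i := fun h => hne (by rw [h])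
    refine ⟨hS.trans (nearestDist_le_dist y hji), ?_⟩
    by_cases hadj : (bondGraph (1 / 100 : ℝ) y).Adj i j
    · exact Or.inl (hL j hadj)
    · exact Or.inr (hG j hji hadj)

/-- Counting form of the partition: `#bad ≤ #scale + #gap`. [this file] -/
theorem badCount_le_scaleCount_add_gapCount {a s : ℝ} {y : Fin N → EuclideanSpace ℝ (Fin 3)} (hy : Function.Injective y) :
    badCount a s y ≤ scaleCount a s y + gapCount a s y := by
  classical
  simp only [badCount, scaleCount, gapCount, Nat.card_eq_fintype_card, Fintype.card_subtype]
  calc (Finset.univ.filter fun i => Bad a s y i).card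
      ≤ ((Finset.univ.filter fun i => Bad a s y i ∧ (Short a s y i ∨ Long a s y i)) ∪
          (Finset.univ.filter fun i => Bad a s y i ∧ Gap a s y i)).card := by
        apply Finset.card_le_card
        intro i hi
        rw [Finset.mem_filter] at hi
        rw [Finset.mem_union, Finset.mem_filter, Finset.mem_filter]
        rcases bad_cases hy hi.2 with h | h | h
        · exact Or.inl ⟨hi.1, hi.2, Or.inl h⟩
        · exact Or.inl ⟨hi.1, hi.2, Or.inr h⟩
        · exact Or.inr ⟨hi.1, hi.2, h⟩
    _ ≤ _ := Finset.card_union_le _ _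

/-- At margin `0`, gap-free shells make every GAP site SHORT (`63/50 · 7/9 = 49/50`), so `#bad ≤ #scale`. [this file] -/
theorem badCount_le_scaleCount_of_gapFree {a : ℝ} (hGF : GapFreeShells) {y : Fin N → EuclideanSpace ℝ (Fin 3)}
    (hy : Function.Injective y) : badCount a 0 y ≤ scaleCount a 0 y := by
  classical
  simp only [badCount, scaleCount, Nat.card_eq_fintype_card, Fintype.card_subtype]
  apply Finset.card_le_card
  intro i hi
  rw [Finset.mem_filter] at hi
  rw [Finset.mem_filter]
  refine ⟨hi.1, hi.2, ?_⟩
  rcases bad_cases hy hi.2 with h | h | h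
  · exact Or.inl h
  · exact Or.inr h
  · obtain ⟨j, hji, hna, hd⟩ := h
    have hgf := hGF N y hy i hi.2.1 j hji hna
    left
    show nearestDist y i < a * (1 - 1 / 50) - 0
    linarith

/-! ## §D  Seams (PROVED) -/

/-- **MEG from its two kernel-weaker pieces** (averaging the two inequalities over the partition). [this file] -/
theorem misfitEnergyGap_of_scale_gap {a s : ℝ} (hS : ScaleEnergyGap a s) (hG : GapEnergyGap a s) : MisfitEnergyGap a s := by
  obtain ⟨c₁, C₁, hc₁, h₁⟩ := hS
  obtain ⟨c₂, C₂, hc₂, h₂⟩ := hG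
  refine ⟨min c₁ c₂ / 2, (C₁ + C₂) / 2, by positivity, fun N y hy => ?_⟩
  have e₁ := h₁ N y hy
  have e₂ := h₂ N y hy
  have hb : (badCount a s y : ℝ) ≤ (scaleCount a s y : ℝ) + (gapCount a s y : ℝ) := by
    exact_mod_cast badCount_le_scaleCount_add_gapCount hy
  have hm0 : 0 ≤ min c₁ c₂ := le_min hc₁.le hc₂.le
  have hsc0 : (0 : ℝ) ≤ scaleCount a s y := Nat.cast_nonneg _
  have hgc0 : (0 : ℝ) ≤ gapCount a s y := Nat.cast_nonneg _
  have h3 : min c₁ c₂ * (badCount a s y : ℝ) ≤ min c₁ c₂ * ((scaleCount a s y : ℝ) + gapCount a s y) :=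
    mul_le_mul_of_nonneg_left hb hm0
  have h4 : min c₁ c₂ * (scaleCount a s y : ℝ) ≤ c₁ * scaleCount a s y := mul_le_mul_of_nonneg_right (min_le_left _ _) hsc0
  have h5 : min c₁ c₂ * (gapCount a s y : ℝ) ≤ c₂ * gapCount a s y := mul_le_mul_of_nonneg_right (min_le_right _ _) hgc0
  nlinarith

/-- **MEG ⇒ SEG** (kernel: SEG prices a subset). [this file] -/
theorem scaleEnergyGap_of_misfitEnergyGap {a s : ℝ} (h : MisfitEnergyGap a s) : ScaleEnergyGap a s := by
  classical
  obtain ⟨c, C, hc, hM⟩ := h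
  refine ⟨c, C, hc, fun N y hy => ?_⟩
  have hle : (scaleCount a s y : ℝ) ≤ badCount a s y := by
    have : scaleCount a s y ≤ badCount a s y := by
      simp only [badCount, scaleCount, Nat.card_eq_fintype_card, Fintype.card_subtype]
      exact Finset.card_le_card (fun i hi => by
        rw [Finset.mem_filter] at hi ⊢
        exact ⟨hi.1, hi.2.1⟩)
    exact_mod_cast this
  have := hM N y hy
  nlinarith

/-- **MEG ⇒ GEG** (kernel: GEG prices a subset). [this file] -/
theorem gapEnergyGap_of_misfitEnergyGap {a s : ℝ} (h : MisfitEnergyGap a s) : GapEnergyGap a s := by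
  classical
  obtain ⟨c, C, hc, hM⟩ := h
  refine ⟨c, C, hc, fun N y hy => ?_⟩
  have hle : (gapCount a s y : ℝ) ≤ badCount a s y := by
    have : gapCount a s y ≤ badCount a s y := by
      simp only [badCount, gapCount, Nat.card_eq_fintype_card, Fintype.card_subtype]
      exact Finset.card_le_card (fun i hi => by
        rw [Finset.mem_filter] at hi ⊢
        exact ⟨hi.1, hi.2.1⟩)
    exact_mod_cast this
  have := hM N y hy
  nlinarith

/-- **MEG at margin `0` from SEG and gap-free shells.** [this file] -/
theorem misfitEnergyGap_zero_of_scale_gapFree {a : ℝ} (hS : ScaleEnergyGap a 0) (hGF : GapFreeShells) : MisfitEnergyGap a 0 := by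
  obtain ⟨c, C, hc, h⟩ := hS
  refine ⟨c, C, hc, fun N y hy => ?_⟩
  have hle : (badCount a 0 y : ℝ) ≤ scaleCount a 0 y := by exact_mod_cast badCount_le_scaleCount_of_gapFree hGF hy
  have := h N y hy
  nlinarith


/-! ## §E  Locality of the relaxed test, packing, and the arithmetic of the glue (PROVED) -/

/-- **`RT` is local.**  Passing the relaxed test in a sub-texture `Y' ⊆ Y` that contains every site of `Y` inside the gap ball of `y` is passing
it in `Y` (`a ≥ 0`: clause 2 is monotone in the texture, clauses 1 and 3 only read the gap ball). [this file] -/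
theorem rt_of_local {a s : ℝ} {Y Y' : Set (EuclideanSpace ℝ (Fin 3))} {y : EuclideanSpace ℝ (Fin 3)} (hY : UniformlyDiscrete Y)
    (hsub : Y' ⊆ Y) (hloc : ∀ w ∈ Y, dist y w < a * (63 / 50) - s → w ∈ Y') (ha : 0 ≤ a) (h : RT a s Y' y) : RT a s Y y := by
  obtain ⟨h1, h2, h3⟩ := h
  refine ⟨?_, ?_, fun w hw hwy => ?_⟩
  · have hEq : {w ∈ Y | w ≠ y ∧ dist y w < a * (63 / 50) - s} = {w ∈ Y' | w ≠ y ∧ dist y w < a * (63 / 50) - s} := by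
      ext w
      exact ⟨fun hw => ⟨hloc w hw.1 hw.2.2, hw.2⟩, fun hw => ⟨hsub hw.1, hw.2⟩⟩
    rw [hEq]
    exact h1
  · exact h2.trans (Set.ncard_le_ncard (fun w hw => ⟨hsub hw.1, hw.2⟩) (window_finite hY y _))
  · by_cases hd : dist y w < a * (63 / 50) - s
    · exact h3 w (hloc w hw hd) hwy
    · push Not at hd
      exact ⟨by linarith, Or.inr hd⟩

/-- Packing: a `δ`-separated finite set in a half-open cube of side `ℓ ≥ δ` has at most `27 ℓ³ / δ³` points
(`…CubeTails.card_le_of_separated_of_box`). [this file] -/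
theorem card_le_of_cube {F : Finset (EuclideanSpace ℝ (Fin 3))} {o : EuclideanSpace ℝ (Fin 3)} {ℓ δ : ℝ} (hδ : 0 < δ)
    (hδℓ : δ ≤ ℓ) (hmem : ∀ z ∈ F, ∀ i : Fin 3, o i ≤ z i ∧ z i < o i + ℓ)
    (hsep : ∀ z ∈ F, ∀ w ∈ F, z ≠ w → δ ≤ dist z w) : (F.card : ℝ) ≤ 27 / δ ^ 3 * ℓ ^ 3 := by
  have hℓpos : 0 < ℓ := lt_of_lt_of_le hδ hδℓ
  have hbox := card_le_of_separated_of_box F (fun i => o i) (fun _ => ℓ) hδ (fun _ => hℓpos.le) hmem hsep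
  rw [Finset.prod_const, Finset.card_univ, Fintype.card_fin] at hbox
  have h3 : 2 * ℓ / δ + 1 ≤ 3 * ℓ / δ := by
    rw [div_add_one (ne_of_gt hδ), div_le_div_iff_of_pos_right hδ]
    linarith
  have h4 : (2 * ℓ / δ + 1) ^ 3 ≤ (3 * ℓ / δ) ^ 3 := by
    apply pow_le_pow_left₀ (by positivity) h3
  calc (F.card : ℝ) ≤ (2 * ℓ / δ + 1) ^ 3 := hbox
    _ ≤ (3 * ℓ / δ) ^ 3 := h4
    _ = 27 / δ ^ 3 * ℓ ^ 3 := by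
      field_simp
      ring

/-- The bookkeeping of the glue as a linear inequality between its eleven atoms. [this file] -/
theorem glue_arith {E U Ne cbad Ccc Cr Cpcc κℓ εN ccc cn : ℝ} (hE : E ≤ Ne + εN) (hG : Ne + cbad - Ccc - Cr ≤ U)
    (h0 : Ccc ≤ Cpcc) (h1 : Cr ≤ κℓ) (h2 : εN ≤ κℓ) (h3 : ccc + Cpcc ≤ κℓ) (h4 : 4 * κℓ ≤ cn) (h5 : cn - ccc ≤ cbad) :
    E + κℓ ≤ U := by
  linarith

/-! ## §E′  The misfit relaxation law (statement) -/

/-- **`MisfitRelax a` («MER»)** — the gross Liouville law stripped of its equilibrium hypotheses: a uniformly discrete, `9/10`-covering texture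
with SPARSE `(1/100)`-charge that carries robust violators of the gapped-twelve test at spacing `a`, `L`-densely, has strained cubes.  (No
recurrence, no thin cores, no clean scale, no local optimality, no virial balance.) -/
def MisfitRelax (a : ℝ) : Prop :=
  ∀ Y : Set (EuclideanSpace ℝ (Fin 3)), UniformlyDiscrete Y → (∀ z : EuclideanSpace ℝ (Fin 3), ∃ w ∈ Y, dist z w ≤ 9 / 10) →
    SparseCharge Y → ∀ t : ℝ, 0 < t → ∀ L : ℝ, ViolatorsL a t L Y → ∃ κ : ℝ, 0 < κ ∧ StrainedCubes κ Y

end Summit.AtomisticToContinuum.Crystallization.Theorems.OverbindingBudgetMisfitCensusStatements
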